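import Mathlib
import Summits.Ventures.PercRepro2.Defs
import Summits.Ventures.PercRepro2.Independence
import Summits.Ventures.PercRepro2.Harris
import Summits.Ventures.PercRepro2.Graph
import Summits.Ventures.PercRepro2.Events
import Summits.Ventures.PercRepro2.Induced
import Summits.Ventures.PercRepro2.ObsIndependence
import Summits.Ventures.PercRepro2.BHKEvents
import Summits.Ventures.PercRepro2.BHKAvoid
import Summits.Ventures.PercRepro2.BHKFibre
import Summits.Ventures.PercRepro2.BTVFamilyDefs
import Summits.Ventures.PercRepro2.BTVFamilyTower
import Summits.Ventures.PercRepro2.BlockConn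
import Summits.Ventures.PercRepro2.BlockFamilyDefs

/-!
# The block family: the base case (blind cell PercRepro2, mine-1 g53;
paper proofs/MINE1-BLOCKS.md §2.4, case `Z = ∅`)

When the frontier sets of the two left-hand cells are disjoint, the block-family inequality is
the fibre-event corollary `BHKFibre.bhk_fibre_four` of the antitone BHK theorem (explored root
`t`), applied to the whole graph with the edges outside `U` pinned closed: the cells `a, b` lie
in its left-hand events (`C_t` hits `W₁` / contains `Vs`; the fibre `G ∖ C_t` satisfies
`Vs ↔ s` / «every block reached by `s`» (increasing) and `s ↮ A₁ ∪ W₁` / `s ↮ W₂` (decreasing);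
`t` avoids `A₁ ∪ Vs ∪ {s}` / `⋃𝒰₂ ∪ W₂ ∪ {s}`), and its right-hand events lie in
`m(A₁ ∩ ⋃𝒰₂, W₁ ∪ W₂)` and `j(A₁ ∪ ⋃𝒰₂, 𝒰₂, W₁ ∩ W₂)` — the join needs no `S`-condition on
`A₁`: its vertices are free.
-/

namespace Summit.Ventures.PercRepro2

namespace BlockFamily

open BTVFamily BHKFibre

section Base

variable {V : Type*} {E : Type*} [Fintype E] [DecidableEq E] [Fintype V] [DecidableEq V]
  {R : Type*} [CommRing R] [LinearOrder R] [IsStrictOrderedRing R]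

omit [Fintype E] [DecidableEq E] [Fintype V] in
/-- `a` on `G[U]` is the whole-graph cell evaluated on the induced configuration. -/
lemma aEv_eq_induced_mem (ends : E → Sym2 V) (U : Finset V) (s t : V) (Vs A W : Finset V) :
    aEv ends U s t Vs A W =
      {ω | induced ends (↑U) ω ∈ ({ω | aProp ends s t Vs A W ω} : Set (Config E))} := rfl

omit [Fintype E] [DecidableEq E] [Fintype V] in
/-- `b` on `G[U]` is the whole-graph cell evaluated on the induced configuration. -/
lemma bEv_eq_induced_mem (ends : E → Sym2 V) (U : Finset V) (s t : V) (Vs : Finset V)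
    (𝒰 : Finset (Finset V)) (W : Finset V) :
    bEv ends U s t Vs 𝒰 W =
      {ω | induced ends (↑U) ω ∈ ({ω | bProp ends s t Vs 𝒰 W ω} : Set (Config E))} := rfl

omit [Fintype E] [DecidableEq E] [Fintype V] in
/-- `j` on `G[U]` is the whole-graph cell evaluated on the induced configuration. -/
lemma jEv_eq_induced_mem (ends : E → Sym2 V) (U : Finset V) (s t : V) (Vs A : Finset V)
    (𝒰 : Finset (Finset V)) (W : Finset V) :
    jEv ends U s t Vs A 𝒰 W =
      {ω | induced ends (↑U) ω ∈ ({ω | jProp ends s t Vs A 𝒰 W ω} : Set (Config E))} := rfl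

omit [Fintype E] [DecidableEq E] [Fintype V] in
/-- `m` on `G[U]` is the whole-graph cell evaluated on the induced configuration. -/
lemma mEv_eq_induced_mem (ends : E → Sym2 V) (U : Finset V) (s t : V) (Vs A W : Finset V) :
    mEv ends U s t Vs A W =
      {ω | induced ends (↑U) ω ∈ ({ω | mProp ends s t Vs A W ω} : Set (Config E))} := rfl

omit [Fintype E] [DecidableEq E] [Fintype V] [DecidableEq V] in
/-- A connection from a vertex outside the cluster of `t` survives in the fibre `G ∖ C_t`. -/
lemma conn_delConfig_of_notMem {ends : E → Sym2 V} {ω : Config E} {t x y : V}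
    (hx : x ∉ cluster ends ω t) (h : Conn ends ω x y) :
    Conn ends (delConfig ends (cluster ends ω t) ω) x y := by
  have e := cluster_delConfig_cluster (ends := ends) (ω := ω) (s := t) (t := x) hx
  have : y ∈ cluster ends (delConfig ends (cluster ends ω t) ω) x := by rw [e]; exact h
  exact this

omit [Fintype E] [DecidableEq E] [Fintype V] [DecidableEq V] in
/-- A connection in the fibre `G ∖ C_t` is a connection in the whole configuration. -/
lemma conn_of_conn_delConfig {ends : E → Sym2 V} {ω : Config E} {W : Set V} {x y : V}
    (h : Conn ends (delConfig ends W ω) x y) : Conn ends ω x y :=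
  conn_mono (delConfig_le W ω) h

omit [Fintype E] [DecidableEq E] [Fintype V] in
/-- (I1) `a(A₁,W₁)` lies in the first left-hand event of `bhk_fibre_four`: `C_t` hits `W₁`, the
fibre satisfies `Vs ↔ s` and `s ↮ A₁ ∪ W₁`, `t` avoids `A₁ ∪ Vs ∪ {s}`. -/
lemma aProp_subset (ends : E → Sym2 V) (s t : V) (Vs A₁ W₁ : Finset V) :
    ({ω | aProp ends s t Vs A₁ W₁ ω} : Set (Config E)) ⊆
      clusterInEvent ends t {L | ∃ y ∈ W₁, y ∈ L} ∩
        fibreEvent ends t ({ω | ∀ v ∈ Vs, Conn ends ω s v} ∩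
          {ω | ∀ x ∈ A₁ ∪ W₁, ¬ Conn ends ω s x}) ∩
          avoidAll ends t (A₁ ∪ Vs ∪ {s}) := by
  rintro ω ⟨h1, h2, h3, h4, _⟩
  have hst : ¬ Conn ends ω s t := fun h =>
    h3 ⟨s, Finset.mem_singleton_self s, t,
      Finset.mem_union_left _ (Finset.mem_union_left _ (Finset.mem_singleton_self t)), h⟩
  have hsL : s ∉ cluster ends ω t := fun h => hst (conn_symm h)
  refine ⟨⟨?_, ?_, ?_⟩, ?_⟩
  · obtain ⟨y, hy, hty⟩ := connSet_singleton_left.1 h2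
    exact ⟨y, hy, hty⟩
  · exact fun v hv => conn_delConfig_of_notMem hsL (conn_symm (h1 v hv))
  · intro x hx hsx
    refine h3 ⟨s, Finset.mem_singleton_self s, x, ?_, conn_of_conn_delConfig hsx⟩
    rw [Finset.union_assoc]
    exact Finset.mem_union_right _ hx
  · intro x hx htx
    simp only [Finset.mem_union, Finset.mem_singleton] at hx
    rcases hx with (hx | hx) | rfl
    · exact h4 ⟨t, Finset.mem_singleton_self t, x, hx, htx⟩
    · exact hst (conn_symm (conn_trans htx (h1 x hx)))
    · exact hst (conn_symm htx)

omit [Fintype E] [DecidableEq E] [Fintype V] in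
/-- (I2) `b(𝒰₂,W₂)` lies in the second left-hand event: `C_t` contains `Vs`, the fibre satisfies
«every block reached by `s`» and `s ↮ W₂`, `t` avoids `⋃𝒰₂ ∪ W₂ ∪ {s}`. -/
lemma bProp_subset (ends : E → Sym2 V) (s t : V) (Vs : Finset V) (𝒰₂ : Finset (Finset V))
    (W₂ : Finset V) :
    ({ω | bProp ends s t Vs 𝒰₂ W₂ ω} : Set (Config E)) ⊆
      clusterInEvent ends t {L | ∀ v ∈ Vs, v ∈ L} ∩
        fibreEvent ends t ({ω | ∀ B ∈ 𝒰₂, ConnSetB ends ω 𝒰₂ {s} B} ∩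
          {ω | ∀ x ∈ W₂, ¬ Conn ends ω s x}) ∩
          avoidAll ends t (unionB 𝒰₂ ∪ W₂ ∪ {s}) := by
  rintro ω ⟨h1, h2, h3, h4, _⟩
  have htav : ∀ x ∈ ({s} : Finset V) ∪ unionB 𝒰₂ ∪ W₂, ¬ Conn ends ω t x := fun x hx h =>
    h3 ⟨t, Finset.mem_singleton_self t, x, hx, h⟩
  have hsL : s ∉ cluster ends ω t :=
    htav s (Finset.mem_union_left _ (Finset.mem_union_left _ (Finset.mem_singleton_self s)))
  have hBL : ∀ B ∈ 𝒰₂, ∀ b ∈ B, b ∉ cluster ends ω t := fun B hB b hb =>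
    htav b (Finset.mem_union_left _ (Finset.mem_union_right _ (subset_unionB hB hb)))
  refine ⟨⟨fun v hv => conn_symm (h2 v hv), ?_, ?_⟩, ?_⟩
  · intro B hB
    obtain ⟨b, hb, hsb⟩ := connSetB_singleton_left.1 (h1 B hB)
    exact connSetB_singleton_left.2 ⟨b, hb, connB_delConfig_of_avoid hsL hBL hsb⟩
  · exact fun x hx hsx => h4 ⟨s, Finset.mem_singleton_self s, x, hx, conn_of_conn_delConfig hsx⟩
  · intro x hx
    refine htav x ?_
    simp only [Finset.mem_union, Finset.mem_singleton] at hx ⊢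
    tauto

omit [Fintype E] [DecidableEq E] [Fintype V] in
/-- (I3) The first right-hand event of `bhk_fibre_four` lies in `m(A₁ ∩ ⋃𝒰₂, W₁ ∪ W₂)` when
`A₁ ∩ ⋃𝒰₂ = ∅`. -/
lemma subset_mProp (ends : E → Sym2 V) (s t : V) (Vs A₁ W₁ : Finset V) (𝒰₂ : Finset (Finset V))
    (W₂ : Finset V) (hA : ∀ x, x ∈ A₁ → x ∈ unionB 𝒰₂ → False) :
    clusterInEvent ends t ({L | ∃ y ∈ W₁, y ∈ L} ∩ {L | ∀ v ∈ Vs, v ∈ L}) ∩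
        fibreEvent ends t ({ω | ∀ x ∈ A₁ ∪ W₁, ¬ Conn ends ω s x} ∩
          {ω | ∀ x ∈ W₂, ¬ Conn ends ω s x}) ∩
          avoidAll ends t ((A₁ ∪ Vs ∪ {s}) ∩ (unionB 𝒰₂ ∪ W₂ ∪ {s})) ⊆
      ({ω | mProp ends s t Vs (A₁ ∩ unionB 𝒰₂) (W₁ ∪ W₂) ω} : Set (Config E)) := by
  rintro ω ⟨⟨⟨⟨y, hy, hty⟩, hVs⟩, hW₁, hW₂⟩, hav⟩
  have hts : ¬ Conn ends ω t s := hav s (by simp)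
  have hsL : s ∉ cluster ends ω t := hts
  refine ⟨⟨t, Finset.mem_singleton_self t, y, Finset.mem_union_left _ hy, hty⟩,
    fun v hv => ⟨v, Finset.mem_singleton_self v, t,
      Finset.mem_union_left _ (Finset.mem_singleton_self t), conn_symm (hVs v hv)⟩, ?_, ?_⟩
  · rintro ⟨s', hs', x, hx, hsx⟩
    rw [Finset.mem_singleton] at hs'
    subst hs'
    simp only [Finset.mem_union, Finset.mem_singleton, Finset.mem_inter] at hx
    rcases hx with (rfl | ⟨hx1, _⟩) | hx | hx
    · exact hts (conn_symm hsx)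
    · exact hW₁ x (Finset.mem_union_left _ hx1) (conn_delConfig_of_notMem hsL hsx)
    · exact hW₁ x (Finset.mem_union_right _ hx) (conn_delConfig_of_notMem hsL hsx)
    · exact hW₂ x hx (conn_delConfig_of_notMem hsL hsx)
  · rintro ⟨_, _, x, hx, _⟩
    exact hA x (Finset.mem_inter.1 hx).1 (Finset.mem_inter.1 hx).2

omit [Fintype E] [DecidableEq E] [Fintype V] in
/-- (I4) The second right-hand event of `bhk_fibre_four` lies in `j(A₁ ∪ ⋃𝒰₂, 𝒰₂, W₁ ∩ W₂)`
when `W₁ ∩ W₂ = ∅`. -/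
lemma subset_jProp (ends : E → Sym2 V) (s t : V) (Vs A₁ W₁ : Finset V) (𝒰₂ : Finset (Finset V))
    (W₂ : Finset V) (hW : ∀ x, x ∈ W₁ → x ∈ W₂ → False) :
    fibreEvent ends t ({ω | ∀ v ∈ Vs, Conn ends ω s v} ∩
        {ω | ∀ B ∈ 𝒰₂, ConnSetB ends ω 𝒰₂ {s} B}) ∩
        avoidAll ends t ((A₁ ∪ Vs ∪ {s}) ∪ (unionB 𝒰₂ ∪ W₂ ∪ {s})) ⊆
      ({ω | jProp ends s t Vs (A₁ ∪ unionB 𝒰₂) 𝒰₂ (W₁ ∩ W₂) ω} : Set (Config E)) := by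
  rintro ω ⟨⟨hsv, hB⟩, hav⟩
  refine ⟨fun B hB' => ?_, fun v hv => connB_of_conn (conn_symm (conn_of_conn_delConfig (hsv v hv))),
    ?_, ?_⟩
  · obtain ⟨b, hb, hsb⟩ := connSetB_singleton_left.1 (hB B hB')
    exact connSetB_singleton_left.2 ⟨b, hb, connB_of_delConfig hsb⟩
  · rintro ⟨t', ht', y, hy, hty⟩
    rw [Finset.mem_singleton] at ht'
    subst ht'
    refine hav y ?_ hty
    simp only [Finset.mem_union, Finset.mem_singleton, Finset.mem_inter] at hy ⊢
    tauto
  · rintro ⟨_, _, y, hy, _⟩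
    exact hW y (Finset.mem_inter.1 hy).1 (Finset.mem_inter.1 hy).2

/-- The base case `Z = ∅`: the fibre-event corollary of the antitone BHK theorem
(`bhk_fibre_four`, explored root `t`) on the whole graph with the edges outside `U` pinned
closed. -/
theorem bfamily_base (p : E → R) (hp : IsProbVec p) (ends : E → Sym2 V) (s t : V)
    (U : Finset V) (Vs A₁ W₁ : Finset V) (𝒰₂ : Finset (Finset V)) (W₂ : Finset V)
    (hZ : (A₁ ∪ W₁) ∩ (unionB 𝒰₂ ∪ W₂) = ∅) :
    prob p (aEv ends U s t Vs A₁ W₁) * prob p (bEv ends U s t Vs 𝒰₂ W₂) ≤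
      prob p (jEv ends U s t Vs (A₁ ∪ unionB 𝒰₂) 𝒰₂ (W₁ ∩ W₂)) *
        prob p (mEv ends U s t Vs (A₁ ∩ unionB 𝒰₂) (W₁ ∪ W₂)) := by
  have hq := isProbVec_pinU hp ends U
  have hA : ∀ x, x ∈ A₁ → x ∈ unionB 𝒰₂ → False := fun x h1 h2 =>
    Finset.notMem_empty x (hZ ▸ Finset.mem_inter.2
      ⟨Finset.mem_union_left _ h1, Finset.mem_union_left _ h2⟩)
  have hW : ∀ x, x ∈ W₁ → x ∈ W₂ → False := fun x h1 h2 =>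
    Finset.notMem_empty x (hZ ▸ Finset.mem_inter.2
      ⟨Finset.mem_union_right _ h1, Finset.mem_union_right _ h2⟩)
  rw [aEv_eq_induced_mem, bEv_eq_induced_mem, jEv_eq_induced_mem, mEv_eq_induced_mem,
    prob_induced_eq_prob_pinU, prob_induced_eq_prob_pinU, prob_induced_eq_prob_pinU,
    prob_induced_eq_prob_pinU]
  have key := bhk_fibre_four (pinU p ends U) hq ends t (A₁ ∪ Vs ∪ {s}) (unionB 𝒰₂ ∪ W₂ ∪ {s})
    (𝓤₁ := {L | ∃ y ∈ W₁, y ∈ L}) (𝓤₂ := {L | ∀ v ∈ Vs, v ∈ L})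
    (A₁ := {ω | ∀ v ∈ Vs, Conn ends ω s v}) (A₂ := {ω | ∀ B ∈ 𝒰₂, ConnSetB ends ω 𝒰₂ {s} B})
    (B₁ := {ω | ∀ x ∈ A₁ ∪ W₁, ¬ Conn ends ω s x}) (B₂ := {ω | ∀ x ∈ W₂, ¬ Conn ends ω s x})
    (fun _ _ h ⟨y, hy, hyL⟩ => ⟨y, hy, h hyL⟩) (fun _ _ h hv v hv' => h (hv v hv'))
    (fun _ _ h hω v hv => conn_mono h (hω v hv))
    (fun _ _ h hω B hB => connSetB_mono_config h (hω B hB))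
    (fun _ _ h hω x hx hc => hω x hx (conn_mono h hc))
    (fun _ _ h hω x hx hc => hω x hx (conn_mono h hc))
  refine le_trans (mul_le_mul (prob_mono hq (aProp_subset ends s t Vs A₁ W₁))
    (prob_mono hq (bProp_subset ends s t Vs 𝒰₂ W₂)) (prob_nonneg hq _) (prob_nonneg hq _)) ?_
  refine le_trans key ?_
  rw [mul_comm (prob (pinU p ends U) {ω | jProp ends s t Vs (A₁ ∪ unionB 𝒰₂) 𝒰₂ (W₁ ∩ W₂) ω})]
  exact mul_le_mul (prob_mono hq (subset_mProp ends s t Vs A₁ W₁ 𝒰₂ W₂ hA))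
    (prob_mono hq (subset_jProp ends s t Vs A₁ W₁ 𝒰₂ W₂ hW)) (prob_nonneg hq _) (prob_nonneg hq _)

end Base

end BlockFamily

end Summit.Ventures.PercRepro2
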